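import Summits.Ventures.PercRepro.Graph

/-!
# Identifying two vertices: the contraction `H / e` on the edges of `G = H − e` (p5, gen 15)

mine-3 (`proofs/MINE3-FLIPS.md` §2): «connectivity in `H / e` is connectivity in `G = H − e` with `u` and `v`
identified; the configurations of `H / e` are the subsets of `E(G)`». `G.contract u v` is the multigraph on
the SAME vertices and edges in which every edge-end at `u` is moved to `v`: `v` is the merged vertex
`w = {u, v}` of `H / e`, `u` becomes an isolated vertex, and the cube of configurations is unchanged — so every
cell count of `H / e` is a cell count of `G.contract u v` (marks other than `u` unchanged), and every
statement about a multigraph (Lemma Φ, Theorem M, …) applies to `H / e` verbatim.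

* `mergeTo u v` (the vertex map `u ↦ v`), `contract`, `contract_fst` / `contract_snd`;
* **`conn_contract_of_conn`** — a path of `G` is a path of the contraction between the images;
* **`conn_contract_imp`** — a path of the contraction from `y` to `z` is a path of `G`, or both `y` and `z`
  are joined in `G` to the pair `{u, v}`;
* `conn_contract_merged_iff` — `y ~ v` in the contraction iff `y ~ u` or `y ~ v` in `G` (`y ≠ u`);
* `eq_of_conn_contract_u` — `u` is isolated in the contraction (`v ≠ u`).
-/

namespace PercRepro

namespace MultiGraph

section Contract

variable {V E : Type*} (G : MultiGraph V E)

open Classical in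
/-- The vertex map of the contraction: `u ↦ v`, every other vertex fixed. -/
noncomputable def mergeTo (u v x : V) : V := if x = u then v else x

/-- `mergeTo` at `u`. -/
theorem mergeTo_self (u v : V) : mergeTo u v u = v := by
  simp [mergeTo]

/-- `mergeTo` away from `u`. -/
theorem mergeTo_of_ne {u v x : V} (h : x ≠ u) : mergeTo u v x = x := by
  simp [mergeTo, h]

/-- The two cases of `mergeTo u v p = x`. -/
theorem eq_cases_of_mergeTo_eq {u v p x : V} (h : mergeTo u v p = x) :
    (p = x ∧ x ≠ u) ∨ (p = u ∧ x = v) := by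
  by_cases hp : p = u
  · right
    refine ⟨hp, ?_⟩
    rw [← h, hp, mergeTo_self]
  · left
    rw [mergeTo_of_ne hp] at h
    exact ⟨h, h ▸ hp⟩

/-- The image of `mergeTo u v` never is `u` when `v ≠ u`. -/
theorem mergeTo_ne_u {u v : V} (huv : v ≠ u) (x : V) : mergeTo u v x ≠ u := by
  by_cases hx : x = u
  · rw [hx, mergeTo_self]
    exact huv
  · rw [mergeTo_of_ne hx]
    exact hx

/-- **The contraction** `G.contract u v`: every edge-end at `u` is moved to `v` (the merged vertex of
`H / e` for `e = uv` is `v`; `u` is left isolated); same vertices, same edges, same configurations. -/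
noncomputable def contract (u v : V) : MultiGraph V E where
  fst e := mergeTo u v (G.fst e)
  snd e := mergeTo u v (G.snd e)

/-- The first endpoint in the contraction. -/
theorem contract_fst (u v : V) (e : E) : (G.contract u v).fst e = mergeTo u v (G.fst e) := rfl

/-- The second endpoint in the contraction. -/
theorem contract_snd (u v : V) (e : E) : (G.contract u v).snd e = mergeTo u v (G.snd e) := rfl

variable {G}

/-- An open edge of `G` joins the images of its endpoints in the contraction. -/
theorem openAdj_contract_of_openAdj {u v : V} {ω : Config E} {y z : V} (h : G.OpenAdj ω y z) :
    (G.contract u v).OpenAdj ω (mergeTo u v y) (mergeTo u v z) := by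
  obtain ⟨e, he, hend⟩ := h
  refine ⟨e, he, ?_⟩
  rw [contract_fst, contract_snd]
  rcases hend with ⟨h1, h2⟩ | ⟨h1, h2⟩
  · exact Or.inl ⟨by rw [h1], by rw [h2]⟩
  · exact Or.inr ⟨by rw [h1], by rw [h2]⟩

/-- **A path of `G` is a path of the contraction** between the images of its ends. -/
theorem conn_contract_of_conn {u v : V} {ω : Config E} {y z : V} (h : G.Conn ω y z) :
    (G.contract u v).Conn ω (mergeTo u v y) (mergeTo u v z) := by
  unfold Conn at h ⊢
  induction h with
  | refl => exact Relation.ReflTransGen.refl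
  | tail _ hbc ih => exact ih.tail (openAdj_contract_of_openAdj hbc)

/-- A path of `G` from a vertex `y ≠ u` to `z ≠ u` is a path of the contraction. -/
theorem conn_contract_of_conn_of_ne {u v : V} {ω : Config E} {y z : V} (hy : y ≠ u) (hz : z ≠ u)
    (h : G.Conn ω y z) : (G.contract u v).Conn ω y z := by
  have := conn_contract_of_conn (u := u) (v := v) h
  rwa [mergeTo_of_ne hy, mergeTo_of_ne hz] at this

/-- A vertex touching the pair `{u, v}` in `G` stays touching along a path of `G`. -/
theorem touch_of_conn {u v : V} {ω : Config E} {y z : V} (h : G.Conn ω y z)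
    (hy : G.Conn ω y u ∨ G.Conn ω y v) : G.Conn ω z u ∨ G.Conn ω z v := by
  rcases hy with hy | hy
  · exact Or.inl (h.symm.trans hy)
  · exact Or.inr (h.symm.trans hy)

/-- **A path of the contraction is a path of `G`, or passes through the merged vertex**: if `y ~ z` in
`G.contract u v`, then `y ~ z` in `G`, or both `y` and `z` are joined in `G` to `u` or to `v`. -/
theorem conn_contract_imp {u v : V} {ω : Config E} {y z : V} (h : (G.contract u v).Conn ω y z) :
    G.Conn ω y z ∨ ((G.Conn ω y u ∨ G.Conn ω y v) ∧ (G.Conn ω z u ∨ G.Conn ω z v)) := by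
  refine Conn.induction
    (motive := fun x => G.Conn ω y x ∨ ((G.Conn ω y u ∨ G.Conn ω y v) ∧ (G.Conn ω x u ∨ G.Conn ω x v)))
    (Or.inl (Conn.refl G ω y)) ?_ h
  intro x z _ hxz ih
  -- the open edge of the contraction, read in `G`: `p ~ q` with `mergeTo p = x`, `mergeTo q = z`
  obtain ⟨p, q, hpq, hp, hq⟩ : ∃ p q, G.Conn ω p q ∧ mergeTo u v p = x ∧ mergeTo u v q = z := by
    obtain ⟨e, he, hend⟩ := hxz
    rw [contract_fst, contract_snd] at hend
    rcases hend with ⟨h1, h2⟩ | ⟨h1, h2⟩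
    · exact ⟨G.fst e, G.snd e, Conn.of_openAdj (G.openAdj_of_open e he), h1, h2⟩
    · exact ⟨G.snd e, G.fst e, Conn.of_openAdj (G.openAdj_of_open e he).symm, h2, h1⟩
  -- once `x` touches `{u, v}`, so does `y`, and the claim for `z` only needs `z` to touch
  have key : (G.Conn ω x u ∨ G.Conn ω x v) → (G.Conn ω z u ∨ G.Conn ω z v) →
      G.Conn ω y z ∨ ((G.Conn ω y u ∨ G.Conn ω y v) ∧ (G.Conn ω z u ∨ G.Conn ω z v)) := by
    intro hx hz
    refine Or.inr ⟨?_, hz⟩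
    rcases ih with hyx | hyx
    · exact touch_of_conn hyx.symm hx
    · exact hyx.1
  rcases eq_cases_of_mergeTo_eq hp with ⟨hpx, _⟩ | ⟨hpu, hxv⟩ <;>
    rcases eq_cases_of_mergeTo_eq hq with ⟨hqz, _⟩ | ⟨hqu, hzv⟩
  · -- `p = x`, `q = z`: a genuine edge of `G`
    rw [hpx, hqz] at hpq
    rcases ih with hyx | hyx
    · exact Or.inl (hyx.trans hpq)
    · exact Or.inr ⟨hyx.1, touch_of_conn hpq hyx.2⟩
  · -- `p = x`, `q = u`, `z = v`
    rw [hpx, hqu] at hpq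
    exact key (Or.inl hpq) (Or.inr (hzv ▸ Conn.refl G ω v))
  · -- `p = u`, `x = v`, `q = z`
    rw [hpu, hqz] at hpq
    exact key (Or.inr (hxv ▸ Conn.refl G ω v)) (Or.inl hpq.symm)
  · -- `p = u`, `x = v`, `q = u`, `z = v`
    exact key (Or.inr (hxv ▸ Conn.refl G ω v)) (Or.inr (hzv ▸ Conn.refl G ω v))

/-- **Connectivity to the merged vertex**: for `y ≠ u`, `y ~ v` in `G.contract u v` iff `y ~ u` or `y ~ v`
in `G`. -/
theorem conn_contract_merged_iff {u v : V} (huv : v ≠ u) {ω : Config E} {y : V} (hy : y ≠ u) :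
    (G.contract u v).Conn ω y v ↔ G.Conn ω y u ∨ G.Conn ω y v := by
  constructor
  · intro h
    rcases conn_contract_imp h with h | h
    · exact Or.inr h
    · exact h.1
  · rintro (h | h)
    · have := conn_contract_of_conn (u := u) (v := v) h
      rwa [mergeTo_of_ne hy, mergeTo_self] at this
    · exact conn_contract_of_conn_of_ne hy huv h

/-- **`u` is isolated in the contraction** (`v ≠ u`): nothing but `u` is joined to `u`. -/
theorem eq_of_conn_contract_u {u v : V} (huv : v ≠ u) {ω : Config E} {z : V}
    (h : (G.contract u v).Conn ω u z) : z = u := by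
  refine Conn.induction (motive := fun x => x = u) rfl ?_ h
  intro x z _ hxz hx
  exfalso
  obtain ⟨e, _, hend⟩ := hxz
  rw [contract_fst, contract_snd] at hend
  rcases hend with ⟨h1, _⟩ | ⟨_, h2⟩
  · exact mergeTo_ne_u huv (G.fst e) (h1.trans hx)
  · exact mergeTo_ne_u huv (G.snd e) (h2.trans hx)

end Contract

end MultiGraph

end PercRepro
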